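import Literature.NumberTheory.Sieve.BombieriFriedlanderIwaniecSiegelWalfisz
import Literature.NumberTheory.LFunctions.LiouvilleSumClassicalBound
import HarnessLib

/-!
# Route `ChenParityOracleBLAP` — crux S1 = `HostParityFromBrick` (stmt-Parity-20045): the divisor switch for `λ(rs + 2)`

Support file for the prime half `K1 → K2 → HP1` of S1 (the unconditional Type-I input).  For odd
coprime `d, r` the Type-I congruence sum `∑_{s ≤ U, s odd, d ∣ rs+2} λ(rs + 2)` is, after the
substitution `rs + 2 = dv` and complete multiplicativity `λ(dv) = λ(d)λ(v)`, the sum of `λ(d)λ(v)`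
over `v ≤ V = ⌊(rU+2)/d⌋` in ONE reduced residue class `l (mod 2r)` (`v` odd, `dv ≡ 2 (mod r)`),
up to at most one boundary term (`dv ≥ r + 2`): `|∑_s … − λ(d) ∑_{v ≤ V, v ≡ l (2r)} λ(v)| ≤ 1`
(`abs_inner_sub_switch_le`).  If `(d, r) > 1` (both odd) the sum is empty
(`inner_eq_zero_of_not_coprime`).  This turns the Type-I sums of HP1 into sums of the Liouville
function in arithmetic progressions to modulus `2r`.

References: E. Bombieri, J. B. Friedlander, H. Iwaniec, Acta Math. 156 (1986) (divisor switching)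
[BombieriFriedlanderIwaniecActa1986]; G. Harman, *Prime-Detecting Sieves* (2007), Ch. 3 [Harman2007].
-/

namespace Summit.Parity.GeneralizedHardyLittlewood.Theorems

open Finset Real
open ArithmeticFunction (liouville)

/-! ### The residue class `l (mod 2r)` -/

/-- For `r` odd and `(d, r) = 1` there is an odd `l < 2r` with `d l ≡ 2 (mod r)`. -/
theorem exists_switch_residue {d r : ℕ} (hr : Odd r) (hcop : Nat.Coprime d r) :
    ∃ l : ℕ, l < 2 * r ∧ Odd l ∧ (r : ℤ) ∣ (d : ℤ) * l - 2 := by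
  have hr1 : 1 ≤ r := hr.pos
  haveI : NeZero r := ⟨by omega⟩
  set u : (ZMod r)ˣ := ZMod.unitOfCoprime d hcop with hu
  have hud : (u : ZMod r) = (d : ZMod r) := ZMod.coe_unitOfCoprime d hcop
  set c : ℕ := (((u⁻¹ : (ZMod r)ˣ) : ZMod r) * 2).val with hc
  have hclt : c < r := ZMod.val_lt _
  have hcmod : (r : ℤ) ∣ (d : ℤ) * c - 2 := by
    rw [← ZMod.intCast_zmod_eq_zero_iff_dvd]
    push_cast
    rw [hc, ZMod.natCast_zmod_val, ← hud, ← mul_assoc, Units.mul_inv, one_mul, sub_self]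
  rcases Nat.even_or_odd c with hce | hco
  · refine ⟨c + r, by omega, hce.add_odd hr, ?_⟩
    have : (d : ℤ) * ((c + r : ℕ) : ℤ) - 2 = ((d : ℤ) * c - 2) + r * d := by push_cast; ring
    rw [this]; exact dvd_add hcmod (dvd_mul_right _ _)
  · exact ⟨c, by omega, hco, hcmod⟩

/-- Such a residue is reduced modulo `2r`. -/
theorem coprime_of_switch_residue {d r l : ℕ} (hl : Odd l)
    (h : (r : ℤ) ∣ (d : ℤ) * l - 2) : l.Coprime (2 * r) := by
  set g := Nat.gcd l (2 * r) with hg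
  have hgl : g ∣ l := Nat.gcd_dvd_left _ _
  have hg2r : g ∣ 2 * r := Nat.gcd_dvd_right _ _
  have hgodd : Odd g := hl.of_dvd_nat hgl
  have hgr : g ∣ r := Nat.Coprime.dvd_of_dvd_mul_left (Nat.coprime_two_right.mpr hgodd) hg2r
  have hg2 : (g : ℤ) ∣ 2 := by
    have h1 : (g : ℤ) ∣ (d : ℤ) * l := (Int.natCast_dvd_natCast.mpr hgl).mul_left _
    have h2 : (g : ℤ) ∣ (d : ℤ) * l - 2 := (Int.natCast_dvd_natCast.mpr hgr).trans h
    have : (2 : ℤ) = (d : ℤ) * l - ((d : ℤ) * l - 2) := by ring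
    rw [this]; exact dvd_sub h1 h2
  have hg2' : g ∣ 2 := by exact_mod_cast hg2
  have hgle : g ≤ 2 := Nat.le_of_dvd (by norm_num) hg2'
  have hgpos : 0 < g := Nat.pos_of_ne_zero (by
    intro h0; rw [h0] at hgodd; exact (Nat.not_odd_iff_even.mpr (by decide)) hgodd)
  rw [Nat.Coprime, ← hg]
  interval_cases g
  · rfl
  · exact absurd hgodd (by decide)

/-- The class condition: for `r ≥ 1` odd, `l` odd with `d l ≡ 2 (mod r)` and `(d, r) = 1`:
`v` is odd with `d v ≡ 2 (mod r)` iff `v ≡ l (mod 2r)`. -/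
theorem switch_class_iff {d r l v : ℕ} (hr : Odd r) (hcop : Nat.Coprime d r) (hl : Odd l)
    (hlr : (r : ℤ) ∣ (d : ℤ) * l - 2) :
    (Odd v ∧ (r : ℤ) ∣ (d : ℤ) * v - 2) ↔ (v : ZMod (2 * r)) = (l : ZMod (2 * r)) := by
  rw [ZMod.natCast_eq_natCast_iff, Nat.modEq_iff_dvd]
  constructor
  · rintro ⟨hvo, hvr⟩
    -- `r ∣ d(l - v)`, `(d,r)=1` ⇒ `r ∣ l - v`; `2 ∣ l - v`; coprime ⇒ `2r ∣ l - v`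
    have h1 : (r : ℤ) ∣ (d : ℤ) * ((l : ℤ) - v) := by
      have : (d : ℤ) * ((l : ℤ) - v) = ((d : ℤ) * l - 2) - ((d : ℤ) * v - 2) := by ring
      rw [this]; exact dvd_sub hlr hvr
    have hrd : IsCoprime (r : ℤ) (d : ℤ) := by
      rw [Int.isCoprime_iff_gcd_eq_one, Int.gcd_natCast_natCast]; exact Nat.coprime_comm.mp hcop
    have h2 : (r : ℤ) ∣ (l : ℤ) - v := hrd.dvd_of_dvd_mul_left h1
    have h3 : (2 : ℤ) ∣ (l : ℤ) - v := by
      obtain ⟨a, ha⟩ := hvo; obtain ⟨b, hb⟩ := hl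
      exact ⟨(b : ℤ) - a, by rw [ha, hb]; push_cast; ring⟩
    have h2r : IsCoprime (2 : ℤ) (r : ℤ) := by
      rw [Int.isCoprime_iff_gcd_eq_one, show (2 : ℤ) = ((2 : ℕ) : ℤ) by norm_num, Int.gcd_natCast_natCast]
      exact hr.coprime_two_left
    push_cast
    exact h2r.mul_dvd h3 h2
  · intro hdvd
    push_cast at hdvd
    obtain ⟨t, ht⟩ := hdvd
    have hv : (v : ℤ) = l - 2 * r * t := by linarith
    constructor
    · have hvodd : Odd (v : ℤ) := by
        rw [hv]
        have hlo : Odd (l : ℤ) := by exact_mod_cast hl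
        exact hlo.sub_even ⟨r * t, by ring⟩
      exact_mod_cast hvodd
    · have : (d : ℤ) * v - 2 = ((d : ℤ) * l - 2) - d * (2 * t) * r := by rw [hv]; ring
      rw [this]
      exact dvd_sub hlr (dvd_mul_left _ _)


/-! ### The substitution `rs + 2 = dv` -/

/-- **Divisor switch.**  For odd `d ≥ 1`, odd `r`:
`∑_{s ≤ U, s odd, d ∣ rs+2} λ(rs+2) = λ(d) ∑_{v ≤ (rU+2)/d, v odd, r ∣ dv−2, dv ≥ r+2} λ(v)`
(the bijection `s ↦ v = (rs+2)/d`, `λ(dv) = λ(d)λ(v)`). -/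
theorem inner_eq_switch {d r : ℕ} (hd : Odd d) (hr : Odd r) (U : ℕ) :
    ∑ s ∈ (Icc 1 U).filter (fun s => Odd s ∧ d ∣ r * s + 2), (liouville (r * s + 2) : ℝ) =
      (liouville d : ℝ) * ∑ v ∈ (Icc 1 ((r * U + 2) / d)).filter
        (fun v : ℕ => Odd v ∧ (r : ℤ) ∣ (d : ℤ) * (v : ℤ) - 2 ∧ r + 2 ≤ d * v), (liouville v : ℝ) := by
  have hd1 : 1 ≤ d := hd.pos
  have hr1 : 1 ≤ r := hr.pos
  rw [Finset.mul_sum]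
  refine Finset.sum_nbij' (fun s : ℕ => (r * s + 2) / d) (fun v : ℕ => (d * v - 2) / r) ?_ ?_ ?_ ?_ ?_
  · intro s hs
    rw [Finset.mem_filter, Finset.mem_Icc] at hs
    obtain ⟨⟨hs1, hsU⟩, hso, hsd⟩ := hs
    obtain ⟨v, hv⟩ := hsd
    have hvdiv : (r * s + 2) / d = v := by rw [hv, Nat.mul_div_cancel_left _ (by omega)]
    rw [hvdiv, Finset.mem_filter, Finset.mem_Icc]
    have hodd : Odd (r * s + 2) := (hr.mul hso).add_even (by decide)
    have hvo : Odd v := by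
      rw [hv] at hodd; exact (Nat.odd_mul.mp hodd).2
    refine ⟨⟨?_, ?_⟩, hvo, ?_, ?_⟩
    · by_contra h; push Not at h
      have : v = 0 := by omega
      rw [this, mul_zero] at hv; omega
    · rw [← hvdiv]; exact Nat.div_le_div_right (by nlinarith)
    · refine ⟨s, ?_⟩
      have : ((d * v : ℕ) : ℤ) = (r * s + 2 : ℕ) := by rw [hv]
      push_cast at this; linarith
    · rw [← hv]; nlinarith
  · intro v hv
    rw [Finset.mem_filter, Finset.mem_Icc] at hv
    obtain ⟨⟨hv1, hvV⟩, hvo, ⟨k, hk⟩, hge⟩ := hv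
    -- `d v - 2 = r k` with `k ≥ 1`
    have hk0 : (0 : ℤ) < k := by
      have : (r : ℤ) * k = (d : ℤ) * v - 2 := by linarith
      have h2 : (0 : ℤ) < (d : ℤ) * v - 2 := by
        have : ((r + 2 : ℕ) : ℤ) ≤ ((d * v : ℕ) : ℤ) := by exact_mod_cast hge
        push_cast at this; linarith
      have hr0 : (0 : ℤ) < r := by exact_mod_cast hr1
      nlinarith
    obtain ⟨kn, hkn⟩ : ∃ kn : ℕ, (kn : ℤ) = k := ⟨k.toNat, Int.toNat_of_nonneg hk0.le⟩
    have hdv : d * v = r * kn + 2 := by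
      have : ((d * v : ℕ) : ℤ) = ((r * kn + 2 : ℕ) : ℤ) := by push_cast; rw [hkn]; linarith
      exact_mod_cast this
    have hsdiv : (d * v - 2) / r = kn := by
      rw [hdv, Nat.add_sub_cancel, Nat.mul_div_cancel_left _ (by omega)]
    rw [hsdiv, Finset.mem_filter, Finset.mem_Icc]
    have hkn1 : 1 ≤ kn := by exact_mod_cast (show (1 : ℤ) ≤ kn by rw [hkn]; omega)
    refine ⟨⟨hkn1, ?_⟩, ?_, ⟨v, hdv.symm⟩⟩
    · -- `r kn = d v - 2 ≤ d V - 2 ≤ r U`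
      have h1 : d * v ≤ d * ((r * U + 2) / d) := Nat.mul_le_mul_left _ hvV
      have h2 : d * ((r * U + 2) / d) ≤ r * U + 2 := Nat.mul_div_le _ _
      have h3 : r * kn ≤ r * U := by omega
      exact Nat.le_of_mul_le_mul_left h3 (by omega)
    · -- parity of `kn`: `r kn = dv - 2` is odd
      have hodd : Odd (d * v) := hd.mul hvo
      have : Odd (r * kn + 2) := by rw [← hdv]; exact hodd
      have h2 : Odd (r * kn) := by
        rcases Nat.even_or_odd (r * kn) with h | h
        · exact absurd this (Nat.not_odd_iff_even.mpr (h.add (by decide)))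
        · exact h
      exact (Nat.odd_mul.mp h2).2
  · intro s hs
    rw [Finset.mem_filter] at hs
    obtain ⟨v, hv⟩ := hs.2.2
    rw [hv, Nat.mul_div_cancel_left _ (by omega), ← hv, Nat.add_sub_cancel,
      Nat.mul_div_cancel_left _ (by omega)]
  · intro v hv
    rw [Finset.mem_filter] at hv
    obtain ⟨-, -, ⟨k, hk⟩, hge⟩ := hv
    have hr0 : (0 : ℤ) < r := by exact_mod_cast hr1
    have h2 : (2 : ℤ) ≤ (d : ℤ) * v := by
      have : ((r + 2 : ℕ) : ℤ) ≤ ((d * v : ℕ) : ℤ) := by exact_mod_cast hge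
      push_cast at this; linarith
    have hk0 : (0 : ℤ) ≤ k := by nlinarith
    obtain ⟨kn, hkn⟩ : ∃ kn : ℕ, (kn : ℤ) = k := ⟨k.toNat, Int.toNat_of_nonneg hk0⟩
    have hdv : d * v = r * kn + 2 := by
      have : ((d * v : ℕ) : ℤ) = ((r * kn + 2 : ℕ) : ℤ) := by push_cast; rw [hkn]; linarith
      exact_mod_cast this
    rw [hdv, Nat.add_sub_cancel, Nat.mul_div_cancel_left _ (by omega), ← hdv,
      Nat.mul_div_cancel_left _ (by omega)]
  · intro s hs
    rw [Finset.mem_filter] at hs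
    obtain ⟨v, hv⟩ := hs.2.2
    rw [hv, Nat.mul_div_cancel_left _ (by omega), ArithmeticFunction.liouville_apply_mul]
    push_cast; ring

/-- At most one `v ≥ 1` with `v ≡ l (mod 2r)` has `dv < r + 2` (`d ≥ 1`, `r ≥ 1`). -/
theorem card_switch_boundary_le_one {d r l V : ℕ} (hd : 1 ≤ d) (hr : 1 ≤ r) :
    #((Icc 1 V).filter (fun v : ℕ => (v : ZMod (2 * r)) = (l : ZMod (2 * r)) ∧ d * v < r + 2)) ≤ 1 := by
  refine Finset.card_le_one.mpr fun a ha b hb => ?_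
  rw [Finset.mem_filter, Finset.mem_Icc] at ha hb
  obtain ⟨⟨ha1, -⟩, hal, had⟩ := ha
  obtain ⟨⟨hb1, -⟩, hbl, hbd⟩ := hb
  have hab : (a : ZMod (2 * r)) = (b : ZMod (2 * r)) := hal.trans hbl.symm
  rw [ZMod.natCast_eq_natCast_iff] at hab
  -- both `a, b ∈ [1, r+1]` and `a ≡ b (mod 2r)` force `a = b`
  have ha' : a < r + 2 := by nlinarith
  have hb' : b < r + 2 := by nlinarith
  rcases le_total a b with h | h
  · have hdvd : 2 * r ∣ b - a := (Nat.modEq_iff_dvd' h).mp hab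
    have hlt : b - a < 2 * r := by omega
    have := Nat.eq_zero_of_dvd_of_lt hdvd hlt
    omega
  · have hdvd : 2 * r ∣ a - b := (Nat.modEq_iff_dvd' h).mp hab.symm
    have hlt : a - b < 2 * r := by omega
    have := Nat.eq_zero_of_dvd_of_lt hdvd hlt
    omega

/-- **The divisor switch, with at most one boundary term.**  For odd `d, r` with `(d, r) = 1` and
the class `l (mod 2r)` of `exists_switch_residue`:
`|∑_{s ≤ U, s odd, d ∣ rs+2} λ(rs+2) − λ(d) ∑_{v ≤ (rU+2)/d, v ≡ l (2r)} λ(v)| ≤ 1`. -/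
theorem abs_inner_sub_switch_le {d r l : ℕ} (hd : Odd d) (hr : Odd r) (hcop : Nat.Coprime d r)
    (hl : Odd l) (hlr : (r : ℤ) ∣ (d : ℤ) * l - 2) (U : ℕ) :
    |(∑ s ∈ (Icc 1 U).filter (fun s => Odd s ∧ d ∣ r * s + 2), (liouville (r * s + 2) : ℝ)) -
      (liouville d : ℝ) * ∑ v ∈ (Icc 1 ((r * U + 2) / d)).filter
        (fun v : ℕ => (v : ZMod (2 * r)) = (l : ZMod (2 * r))), (liouville v : ℝ)| ≤ 1 := by
  classical
  have hd1 : 1 ≤ d := hd.pos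
  have hr1 : 1 ≤ r := hr.pos
  set V := (r * U + 2) / d with hV
  rw [inner_eq_switch hd hr U]
  -- rewrite the class condition
  have hcls : (Icc 1 V).filter (fun v : ℕ => Odd v ∧ (r : ℤ) ∣ (d : ℤ) * (v : ℤ) - 2 ∧ r + 2 ≤ d * v) =
      (Icc 1 V).filter (fun v : ℕ => (v : ZMod (2 * r)) = (l : ZMod (2 * r)) ∧ r + 2 ≤ d * v) := by
    refine Finset.filter_congr fun v _ => ?_
    rw [← and_assoc, switch_class_iff hr hcop hl hlr]
  rw [hcls]
  -- split the full class sum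
  have hsplit : ∑ v ∈ (Icc 1 V).filter (fun v : ℕ => (v : ZMod (2 * r)) = (l : ZMod (2 * r))),
      (liouville v : ℝ) =
      (∑ v ∈ (Icc 1 V).filter (fun v : ℕ => (v : ZMod (2 * r)) = (l : ZMod (2 * r)) ∧ r + 2 ≤ d * v),
        (liouville v : ℝ)) +
      ∑ v ∈ (Icc 1 V).filter (fun v : ℕ => (v : ZMod (2 * r)) = (l : ZMod (2 * r)) ∧ d * v < r + 2),
        (liouville v : ℝ) := by
    rw [← Finset.sum_filter_add_sum_filter_not ((Icc 1 V).filter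
      (fun v : ℕ => (v : ZMod (2 * r)) = (l : ZMod (2 * r)))) (fun v => r + 2 ≤ d * v),
      Finset.filter_filter, Finset.filter_filter]
    congr 2
    refine Finset.filter_congr fun v _ => ?_
    simp only [not_le]
  rw [hsplit, mul_add]
  have hld : |(liouville d : ℝ)| ≤ 1 := Literature.NumberTheory.LFunctions.LiouvilleSum.abs_liouville_le_one d
  have hsmall : |∑ v ∈ (Icc 1 V).filter
      (fun v : ℕ => (v : ZMod (2 * r)) = (l : ZMod (2 * r)) ∧ d * v < r + 2), (liouville v : ℝ)| ≤ 1 := by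
    calc _ ≤ ∑ v ∈ (Icc 1 V).filter
          (fun v : ℕ => (v : ZMod (2 * r)) = (l : ZMod (2 * r)) ∧ d * v < r + 2), |(liouville v : ℝ)| :=
          Finset.abs_sum_le_sum_abs _ _
      _ ≤ ∑ _v ∈ (Icc 1 V).filter
          (fun v : ℕ => (v : ZMod (2 * r)) = (l : ZMod (2 * r)) ∧ d * v < r + 2), (1 : ℝ) :=
          Finset.sum_le_sum fun v _ => Literature.NumberTheory.LFunctions.LiouvilleSum.abs_liouville_le_one v
      _ = #((Icc 1 V).filter (fun v : ℕ => (v : ZMod (2 * r)) = (l : ZMod (2 * r)) ∧ d * v < r + 2)) := by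
          simp
      _ ≤ 1 := by exact_mod_cast card_switch_boundary_le_one (V := V) (l := l) hd1 hr1
  rw [show ∀ a b : ℝ, a - (a + b) = -b from fun a b => by ring, abs_neg, abs_mul]
  calc |(liouville d : ℝ)| * _ ≤ 1 * 1 := mul_le_mul hld hsmall (abs_nonneg _) zero_le_one
    _ = 1 := one_mul _

/-- If `d, r` are odd and NOT coprime, no odd `s` has `d ∣ rs + 2` (a common prime factor would
divide `2`): the Type-I congruence sum is empty. -/
theorem inner_eq_zero_of_not_coprime {d r : ℕ} (hd : Odd d) (hcop : ¬ Nat.Coprime d r) (U : ℕ) :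
    ∑ s ∈ (Icc 1 U).filter (fun s => Odd s ∧ d ∣ r * s + 2), (liouville (r * s + 2) : ℝ) = 0 := by
  refine Finset.sum_eq_zero fun s hs => ?_
  exfalso
  rw [Finset.mem_filter] at hs
  obtain ⟨-, -, hds⟩ := hs
  apply hcop
  rw [Nat.Coprime]
  by_contra hg
  obtain ⟨p, hp, hpg⟩ := Nat.exists_prime_and_dvd hg
  have hpd : p ∣ d := hpg.trans (Nat.gcd_dvd_left _ _)
  have hpr : p ∣ r := hpg.trans (Nat.gcd_dvd_right _ _)
  have hp2 : p ∣ 2 := by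
    have h1 : p ∣ r * s + 2 := hpd.trans hds
    have h2 : p ∣ r * s := hpr.mul_right _
    exact (Nat.dvd_add_right h2).mp h1
  have hple : p ≤ 2 := Nat.le_of_dvd (by norm_num) hp2
  have hp2' : p = 2 := by have := hp.two_le; omega
  subst hp2'
  exact (Nat.not_even_iff_odd.mpr hd) (even_iff_two_dvd.mpr hpd)

end Summit.Parity.GeneralizedHardyLittlewood.Theorems
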